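import Summits.ValiantsHypothesis.ValiantsHypothesis.Theorems.LacunarySymmetroidMatrixDescartesCensusDoorA26Ray0002030715
import Summits.ValiantsHypothesis.ValiantsHypothesis.Theorems.LacunarySymmetroidMatrixDescartesCensusBox000203071525Pos
import Summits.ValiantsHypothesis.ValiantsHypothesis.Theorems.LacunarySymmetroidMatrixDescartesCensusBox000203071526Pos

/-!
# `MatrixDescartes` census — the ray `(0,2,3,7,15,N)` is COMPLETE: door-A row for EVERY `N`

HONEST FRAMING.  Object-search cell `pub-symmetroid`, door-A item `Theses.LacunarySymmetroid.DoorA26 = PosRootLawAt 2 6 19`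
(stmt-ValiantsHypothesis-19979; OPEN, typed, never asserted).  The ray `(0,2,3,7,15,N)` is the one uniform far-top family of record that
passes THROUGH the V = 20 open core: the punctured-ray theorem `Census.doorA26_on_punctured_ray_0_2_3_7_15` (door-p1 g2) covers every
`N ∉ {25, 26}`, and the two punctures `(0,2,3,7,15,25)+`, `(0,2,3,7,15,26)+` were OPEN cells of engine-3's open core of record (LP-alive
under Lorentz + Newton rows; complex-Hermitian (1,3) twenties exist there).  They are now closed IN THE KERNEL by RANK ROWS — case trees of
monomial-ratio splits whose leaves are single-monomial dominations of `4 × 4` would-be-Gram minors (`= 0` for six letters in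
`Sym₂(ℝ) ≅ ℝ^{1,2}`), theory g19/g20's reader chain replayed with independently re-derived exact LPs at the val-sym-door-p1 g3 seat
(`Census.doorA26_on_0_2_3_7_15_25`, `Census.doorA26_on_0_2_3_7_15_26`).  Hence `doorA26_on_ray_0_2_3_7_15 : ∀ N, PosRootLawOn 2 6 19
(0,2,3,7,15,N)` — the fourteenth COMPLETE ray — and `no_twenty_on_ray_0_2_3_7_15`.  ONE one-parameter family of supports; nothing on
`DoorA26` over all supports (OPEN), on `V = 19`, on the crux `MatrixDescartes` (stmt-ValiantsHypothesis-18050) or on `VP ≠ VNP`.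

[folklore] Assembly of kernel theorems of the tree; elementary.
-/

-- `Summit.ValiantsHypothesis.ValiantsHypothesis.…` repeats a component by the D-0017 layout
-- (single-conjunct summit), which the `dupNamespace` linter flags; the name is mandated.
set_option linter.dupNamespace false

namespace Summit.ValiantsHypothesis.ValiantsHypothesis.Theorems.LacunarySymmetroidMatrixDescartes.Census

open Polynomial Finset
open scoped BigOperators Polynomial Matrix
open Summit.ValiantsHypothesis.ValiantsHypothesis.Theorems.MatrixDescartes.Negative (PosRootLawAt)

/-- **Door A on the WHOLE ray `(0,2,3,7,15,N)`**: `ζ(2,6; 0,2,3,7,15,N) ≤ 19` for every `N` — the punctured ray (`N ∉ {25,26}`)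
plus the two former open-core cells `N = 25, 26`, closed by rank-row case trees. [folklore] -/
theorem doorA26_on_ray_0_2_3_7_15 (N : ℕ) : PosRootLawOn 2 6 19 (![0, 2, 3, 7, 15, N] : Fin 6 → ℕ) := by
  by_cases h25 : N = 25
  · subst h25; exact doorA26_on_0_2_3_7_15_25
  by_cases h26 : N = 26
  · subst h26; exact doorA26_on_0_2_3_7_15_26
  exact doorA26_on_punctured_ray_0_2_3_7_15 N h25 h26

/-- **No twenty anywhere on the ray**: a real symmetric `2 × 2` pencil on `(0,2,3,7,15,N)` has at most `19` distinct positive det-roots,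
stated as the negation of the `20`-roots hypothesis (the form `Census.twenty_on_ray_0_2_3_7_15_only` left open at `N = 25, 26`). [folklore] -/
theorem no_twenty_on_ray_0_2_3_7_15 (N : ℕ) (S : Fin 6 → Matrix (Fin 2) (Fin 2) ℝ) (hS : ∀ l, (S l).IsSymm) :
    ¬ 20 ≤ ((∑ l, ((X : ℝ[X]) ^ (![0, 2, 3, 7, 15, N] : Fin 6 → ℕ) l) • (S l).map C).det.roots.toFinset.filter (fun t => 0 < t)).card := by
  intro hZ
  have h19 := doorA26_on_ray_0_2_3_7_15 N S hS
  exact absurd (le_trans hZ h19) (by norm_num)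

end Summit.ValiantsHypothesis.ValiantsHypothesis.Theorems.LacunarySymmetroidMatrixDescartes.Census
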